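import Literature.Analysis.Complex.LaurentExpansionGerms
import Literature.RingTheory.PowerSeries.LaurentSeriesConstants
import Mathlib.Analysis.SpecialFunctions.ExpDeriv
import HarnessLib

/-!
# Laurent expansion of germs: polynomial relations and derivatives

Sequel of `LaurentExpansionGerms.lean` (namespace `Literature.Analysis.Complex.LaurentGerm`,
same local notations `𝓣[f]`, `𝓛[n, f]`). Everything PROVED, no definition.

* `laurent_sum`, `laurent_eval` — the Laurent expansion of `P(f, g)` (`P ∈ ℂ[X, Y]`) is
  `P(𝓛 f, 𝓛 g)`; hence (`aeval_laurent_eq_zero`) a polynomial relation `P(f, g) = 0` holding on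
  a punctured neighbourhood of `0` holds between the Laurent expansions in the field `ℂ⸨X⸩`;
* `taylor_deriv`, `derivative_laurent_of_analyticAt` — the expansion intertwines `d/dz` with
  the formal derivative `d/dX`;
* `derivative_laurent_exp` — for an analytic germ `ℓ`, `(e^ℓ)^ = (e^ℓ)^ · ℓ^′`: the exponential
  relation `D z = z · D y` of Ax's theorem for `y = 𝓛 ℓ`, `z = 𝓛 e^ℓ`.

[folklore]

## References

* R. Remmert, *Theory of Complex Functions*, GTM 122, Springer 1991, Ch. 12 §1. [folklore]
-/

noncomputable section

open Complex Filter Topology Set PowerSeries HahnSeries LaurentSeries MvPolynomial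
open scoped Nat

namespace Literature.Analysis.Complex

namespace LaurentGerm

open Literature.NumberTheory.Transcendental.AndreCriterion (coeff_taylor constantCoeff_taylor
  taylor_congr taylor_add taylor_const_mul taylor_mul taylor_one taylor_pow)
open Literature.Analysis.Complex.FormalRoot (taylor_eq_zero_iff taylor_sub eventuallyEq_of_taylor_eq
  taylor_polynomial taylor_pow_id)
open Literature.RingTheory.PowerSeries (derivative_coe_powerSeries algebraMap_laurentSeries_apply)

/-- The Taylor series of `f : ℂ → ℂ` at `0`, as a formal power series (local notation). -/
local notation3 "𝓣[" f "]" =>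
  (PowerSeries.mk fun n => ((Nat.factorial n : ℂ)⁻¹ * iteratedDeriv n f 0) : PowerSeries ℂ)

/-- The Laurent expansion at `0` of a germ `f` with `zⁿ f(z)` analytic at `0` (local notation). -/
local notation3 "𝓛[" n ", " f "]" =>
  (HahnSeries.single (-((n : ℕ) : ℤ)) (1 : ℂ) *
    HahnSeries.ofPowerSeries ℤ ℂ 𝓣[fun z : ℂ => z ^ (n : ℕ) * (f : ℂ → ℂ) z] : LaurentSeries ℂ)

/-! ### Finite sums -/

/-- Analyticity hypothesis for a finite sum. [folklore] -/
theorem analyticAt_sum {α : Type*} (s : Finset α) {F : α → ℂ → ℂ} {N : ℕ}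
    (h : ∀ i ∈ s, AnalyticAt ℂ (fun z => z ^ N * F i z) 0) :
    AnalyticAt ℂ (fun z : ℂ => z ^ N * ∑ i ∈ s, F i z) 0 := by
  have hfun : (fun z : ℂ => z ^ N * ∑ i ∈ s, F i z) = fun z => ∑ i ∈ s, z ^ N * F i z := by
    funext z; rw [Finset.mul_sum]
  rw [hfun]
  exact Finset.analyticAt_fun_sum s h

/-- **`𝓛` of a finite sum.** [folklore] -/
theorem laurent_sum {α : Type*} (s : Finset α) {F : α → ℂ → ℂ} {N : ℕ}
    (h : ∀ i ∈ s, AnalyticAt ℂ (fun z => z ^ N * F i z) 0) :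
    𝓛[N, fun z => ∑ i ∈ s, F i z] = ∑ i ∈ s, 𝓛[N, F i] := by
  classical
  induction s using Finset.induction_on with
  | empty =>
    simp only [Finset.sum_empty]
    have h0 : 𝓛[N, fun _ : ℂ => (0 : ℂ)] = 0 := by
      rw [laurent_eq_zero_iff]
      · exact Filter.Eventually.of_forall fun _ => rfl
      · simp only [mul_zero]; exact analyticAt_const
    exact h0
  | insert a s ha ih =>
    have hs : ∀ i ∈ s, AnalyticAt ℂ (fun z => z ^ N * F i z) 0 := fun i hi =>
      h i (Finset.mem_insert_of_mem hi)
    have hfun : (fun z : ℂ => ∑ i ∈ insert a s, F i z) = fun z => F a z + ∑ i ∈ s, F i z := by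
      funext z; rw [Finset.sum_insert ha]
    rw [hfun, Finset.sum_insert ha, laurent_add (h a (Finset.mem_insert_self a s)) (analyticAt_sum s hs),
      ih hs]

/-! ### Monomials and polynomial relations in two germs -/

/-- Analyticity hypothesis for a monomial `f^a g^b` with exponent `N ≥ n a + m b`. [folklore] -/
theorem analyticAt_monomial {f g : ℂ → ℂ} {n m : ℕ} (hf : AnalyticAt ℂ (fun z => z ^ n * f z) 0)
    (hg : AnalyticAt ℂ (fun z => z ^ m * g z) 0) {a b N : ℕ} (hN : n * a + m * b ≤ N) :
    AnalyticAt ℂ (fun z : ℂ => z ^ N * (f z ^ a * g z ^ b)) 0 := by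
  obtain ⟨-, ha⟩ := laurent_pow hf a
  obtain ⟨-, hb⟩ := laurent_pow hg b
  have hab := analyticAt_mul ha hb
  obtain ⟨k, hk⟩ := Nat.exists_eq_add_of_le hN
  rw [hk]
  exact analyticAt_pow_add hab k

/-- `𝓛` of a monomial: `𝓛[N, f^a g^b] = 𝓛[n, f]^a 𝓛[m, g]^b` for `N ≥ n a + m b`. [folklore] -/
theorem laurent_monomial {f g : ℂ → ℂ} {n m : ℕ} (hf : AnalyticAt ℂ (fun z => z ^ n * f z) 0)
    (hg : AnalyticAt ℂ (fun z => z ^ m * g z) 0) {a b N : ℕ} (hN : n * a + m * b ≤ N) :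
    𝓛[N, fun z => f z ^ a * g z ^ b] = 𝓛[n, f] ^ a * 𝓛[m, g] ^ b := by
  obtain ⟨hfa, ha⟩ := laurent_pow hf a
  obtain ⟨hgb, hb⟩ := laurent_pow hg b
  have hab := analyticAt_mul ha hb
  rw [laurent_eq_of_analyticAt (analyticAt_monomial hf hg hN) hab, laurent_mul ha hb, hfa, hgb]

/-- **`𝓛` of a polynomial in two germs**: for `P ∈ ℂ[X, Y]` and `N ≥ (n + m) · deg P`,
`𝓛[N, P(f, g)] = P(𝓛[n, f], 𝓛[m, g])`. [folklore] -/
theorem laurent_eval {f g : ℂ → ℂ} {n m : ℕ} (hf : AnalyticAt ℂ (fun z => z ^ n * f z) 0)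
    (hg : AnalyticAt ℂ (fun z => z ^ m * g z) 0) (P : MvPolynomial (Fin 2) ℂ) {N : ℕ}
    (hN : (n + m) * P.totalDegree ≤ N) :
    𝓛[N, fun z => MvPolynomial.eval ![f z, g z] P] =
        MvPolynomial.aeval ![𝓛[n, f], 𝓛[m, g]] P ∧
      AnalyticAt ℂ (fun z : ℂ => z ^ N * MvPolynomial.eval ![f z, g z] P) 0 := by
  classical
  -- exponent bookkeeping for the monomials in the support
  have hmono : ∀ d ∈ P.support, n * d 0 + m * d 1 ≤ N := by
    intro d hd
    have h1 : d 0 + d 1 ≤ P.totalDegree := by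
      have := MvPolynomial.le_totalDegree hd
      rw [Finsupp.sum_fintype d _ (fun _ => rfl)] at this
      simpa [Fin.sum_univ_two] using this
    calc n * d 0 + m * d 1 ≤ (n + m) * d 0 + (n + m) * d 1 := by
          gcongr <;> omega
      _ = (n + m) * (d 0 + d 1) := by ring
      _ ≤ (n + m) * P.totalDegree := Nat.mul_le_mul_left _ h1
      _ ≤ N := hN
  -- `P(f, g)` as a sum over the support
  have heval' : ∀ z : ℂ, MvPolynomial.eval ![f z, g z] P =
      ∑ d ∈ P.support, P.coeff d * (f z ^ d 0 * g z ^ d 1) := by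
    intro z
    rw [MvPolynomial.eval_eq']
    simp only [Fin.prod_univ_two, Matrix.cons_val_zero, Matrix.cons_val_one]
  have heval : (fun z : ℂ => MvPolynomial.eval ![f z, g z] P) =
      fun z => ∑ d ∈ P.support, P.coeff d * (f z ^ d 0 * g z ^ d 1) := funext heval'
  have hterm : ∀ d ∈ P.support,
      AnalyticAt ℂ (fun z : ℂ => z ^ N * (P.coeff d * (f z ^ d 0 * g z ^ d 1))) 0 := fun d hd =>
    analyticAt_const_mul (analyticAt_monomial hf hg (hmono d hd)) _
  have han := analyticAt_sum P.support hterm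
  have hsum := laurent_sum P.support hterm
  beta_reduce at han hsum
  refine ⟨?_, han.congr (Filter.Eventually.of_forall fun z => by beta_reduce; rw [heval'])⟩
  beta_reduce
  simp only [heval']
  rw [hsum, MvPolynomial.aeval_def, MvPolynomial.eval₂_eq']
  refine Finset.sum_congr rfl fun d hd => ?_
  have hcm := laurent_const_mul (f := fun z => f z ^ d 0 * g z ^ d 1) (n := N) (P.coeff d)
  have hmon := laurent_monomial hf hg (hmono d hd)
  beta_reduce at hcm hmon
  rw [hcm, hmon, algebraMap_laurentSeries_apply, Fin.prod_univ_two]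
  simp only [Matrix.cons_val_zero, Matrix.cons_val_one]

/-- **Polynomial relations pass to Laurent expansions.** If `P(f, g) = 0` on a punctured
neighbourhood of `0` then `P(𝓛 f, 𝓛 g) = 0` in `ℂ⸨X⸩`. [folklore] -/
theorem aeval_laurent_eq_zero {f g : ℂ → ℂ} {n m : ℕ} (hf : AnalyticAt ℂ (fun z => z ^ n * f z) 0)
    (hg : AnalyticAt ℂ (fun z => z ^ m * g z) 0) (P : MvPolynomial (Fin 2) ℂ)
    (h : ∀ᶠ z in 𝓝[≠] (0 : ℂ), MvPolynomial.eval ![f z, g z] P = 0) :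
    MvPolynomial.aeval ![𝓛[n, f], 𝓛[m, g]] P = 0 := by
  obtain ⟨h1, h2⟩ := laurent_eval hf hg P le_rfl
  beta_reduce at h1
  rw [← h1, laurent_eq_zero_iff h2]
  exact h

/-! ### Derivatives -/

/-- **Taylor series of the derivative**: `𝓣[f′] = d⁄dX 𝓣[f]`. [folklore] -/
theorem taylor_deriv (f : ℂ → ℂ) : 𝓣[deriv f] = PowerSeries.derivative ℂ 𝓣[f] := by
  ext n
  rw [coeff_taylor, PowerSeries.coeff_derivative, coeff_taylor, ← iteratedDeriv_succ']
  have hn : ((n ! : ℕ) : ℂ) ≠ 0 := by exact_mod_cast Nat.factorial_ne_zero n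
  have hn1 : (((n + 1)! : ℕ) : ℂ) ≠ 0 := by exact_mod_cast Nat.factorial_ne_zero (n + 1)
  rw [Nat.factorial_succ]
  push_cast
  field_simp

/-- The Laurent expansion of an analytic germ intertwines `d/dz` and `d/dX`:
`d⁄dX 𝓣[f] = 𝓣[f′]` in `ℂ⸨X⸩`. [folklore] -/
theorem derivative_ofPowerSeries_taylor (f : ℂ → ℂ) :
    LaurentSeries.derivative ℂ (HahnSeries.ofPowerSeries ℤ ℂ 𝓣[f]) =
      HahnSeries.ofPowerSeries ℤ ℂ 𝓣[deriv f] := by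
  rw [taylor_deriv]
  exact derivative_coe_powerSeries _

/-- **The exponential relation.** For a germ `ℓ` analytic at `0` and `y = e^ℓ`:
`d⁄dX ŷ = ŷ · d⁄dX ℓ̂` for the Taylor series in `ℂ⸨X⸩` (the hypothesis `D z = z · D y` of Ax's
theorem). [folklore] -/
theorem derivative_taylor_exp {ℓ : ℂ → ℂ} (hℓ : AnalyticAt ℂ ℓ 0) :
    LaurentSeries.derivative ℂ (HahnSeries.ofPowerSeries ℤ ℂ 𝓣[fun z => exp (ℓ z)]) =
      HahnSeries.ofPowerSeries ℤ ℂ 𝓣[fun z => exp (ℓ z)] *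
        LaurentSeries.derivative ℂ (HahnSeries.ofPowerSeries ℤ ℂ 𝓣[ℓ]) := by
  rw [derivative_ofPowerSeries_taylor, derivative_ofPowerSeries_taylor, ← map_mul]
  congr 1
  have hexp : AnalyticAt ℂ (fun z => exp (ℓ z)) 0 := analyticAt_cexp.comp hℓ
  have hder : deriv (fun z => exp (ℓ z)) =ᶠ[𝓝 0] fun z => exp (ℓ z) * deriv ℓ z := by
    filter_upwards [hℓ.eventually_analyticAt] with z hz
    exact ((Complex.hasDerivAt_exp (ℓ z)).comp z hz.differentiableAt.hasDerivAt).deriv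
  rw [taylor_congr hder]
  exact taylor_mul hexp hℓ.deriv

end LaurentGerm

end Literature.Analysis.Complex

end
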